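import Literature.Probability.LatticeModels.BalabanStepOneFormatXYActivity

/-!
# Balaban's step-one format — a-priori large-field suppression and the small-field representation

Two elementary consequences of the format that every ENGINE proof over
`Literature.Probability.LatticeModels.BalabanStepOne.StepOneFormat` starts from (crux `BirFormatEngine`
of route BalabanIR, `HubbardSuperconductivity`; Balaban CMP 167 (1995) §1: the large-field Peierls
input and the small-field Gibbs factor):

* `misalign_ge_card_lfSet` — the misalignment energy dominates the number of large-field sites:
  `(1 - cos η(K)) · |LF θ| / 2 ≤ misalign θ` (every large-field site owns an incident bond with
  `1 - cos ∂θ ≥ 1 - cos η`, a bond has two endpoints: `sum_touch_ge`);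
* `CoerciveWeight.norm_le_exp_card_lfSet` — hence W4 alone gives ONE EXPONENTIALLY SMALL FACTOR PER
  LARGE-FIELD SITE for every coercive weight: `‖ρ θ‖ ≤ exp (-(c₀K (1 - cos η(K)) / 2) · |LF θ|)`
  (`≈ exp (-(c₀/4) log² K · |LF θ|)`), the entropy-beating estimate of the large-field expansion;
* `StepOneFormat.apply_of_lfSet_eq_empty` — on a small-field configuration (`LF θ = ∅`) a format
  weight IS the Gibbs factor of its small-field action: `ρ θ = exp (-Σ_X A X θ)`;
* `CoerciveWeight.mul_misalign_le_re_of_eq_cexp`, `StepOneFormat.exists_action_re_ge` — and then W4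
  says the action is COERCIVE there: `c₀ K · misalign θ ≤ Re Σ_X A X θ` (Gaussian positivity input).

Folklore; no fact about any engine is asserted.
-/

noncomputable section

open scoped BigOperators Classical
open Finset

namespace Literature.Probability.LatticeModels.BalabanStepOne

variable {L' M : ℕ} [NeZero L'] [NeZero M]

/-- The misalignment energy as a sum over bonds. [folklore] -/
theorem misalign_eq_sum_bondEnergy (θ : Site L' M → ℝ) :
    misalign θ = ∑ b : Site L' M × Fin 3, (1 - Real.cos (θ (b.1 + dir L' M b.2) - θ b.1)) := by
  rw [Fintype.sum_prod_type]
  rfl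

/-- **The misalignment energy dominates the number of large-field sites**:
`(1 - cos η(K)) · |lfSet K θ| / 2 ≤ misalign θ`. [folklore] -/
theorem misalign_ge_card_lfSet (K : ℝ) (θ : Site L' M → ℝ) :
    (1 - Real.cos (eta K)) * ((lfSet K θ).card : ℝ) / 2 ≤ misalign θ := by
  refine (sum_touch_ge (K := K) (θ := θ) (D := lfSet K θ) Subset.rfl).trans ?_
  rw [misalign_eq_sum_bondEnergy]
  refine sum_le_sum_of_subset_of_nonneg (filter_subset _ _) fun b _ _ => ?_
  linarith [Real.cos_le_one (θ (b.1 + dir L' M b.2) - θ b.1)]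

/-- **A-priori large-field suppression (one small factor per large-field site).** A coercive weight
with rate `c₀K ≥ 0` satisfies `‖ρ θ‖ ≤ exp (-(c₀ K (1 - cos η(K)) / 2) · |lfSet K θ|)`. [folklore] -/
theorem CoerciveWeight.norm_le_exp_card_lfSet {K c₀ : ℝ} {ρ : (Site L' M → ℝ) → ℂ}
    (h : CoerciveWeight K c₀ L' M ρ) (hK : 0 ≤ c₀ * K) (θ : Site L' M → ℝ) :
    ‖ρ θ‖ ≤ Real.exp (-(c₀ * K * (1 - Real.cos (eta K)) / 2) * ((lfSet K θ).card : ℝ)) := by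
  refine (h.coercive θ).trans ?_
  rw [Real.exp_le_exp]
  have h1 := misalign_ge_card_lfSet K θ
  have h2 := mul_le_mul_of_nonneg_left h1 hK
  nlinarith

/-- **The small-field representation.** On a configuration without large-field sites a format weight
is the Gibbs factor of its small-field action summed over ALL site sets. [folklore] -/
theorem StepOneFormat.apply_of_lfSet_eq_empty {K B c₀ cL κ : ℝ} {ρ : (Site L' M → ℝ) → ℂ}
    (h : StepOneFormat K B c₀ cL κ L' M ρ) {θ : Site L' M → ℝ} (hθ : lfSet K θ = ∅) :
    ∃ (A : Finset (Site L' M) → (Site L' M → ℂ) → ℂ), QuasiLocalAction K B κ L' M A ∧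
      ρ θ = Complex.exp (-(∑ X : Finset (Site L' M), A X (fun s => (θ s : ℂ)))) := by
  obtain ⟨-, A, g, hA, -, hrep⟩ := h
  refine ⟨A, hA, ?_⟩
  rw [hrep θ, hθ, sum_adm_empty, mul_one]
  congr 2
  refine sum_congr ?_ fun X _ => rfl
  ext X
  simp

/-- **Coercivity of the small-field action.** If a coercive weight is the Gibbs factor of an action on
some configuration, `ρ θ = exp (-S)`, then `Re S ≥ c₀ K · misalign θ` there (W4 read through the
representation: the Gaussian part of a complex format member is not only real but POSITIVE, dominating
`c₀K` times the lattice Laplacian form to second order). [folklore] -/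
theorem CoerciveWeight.mul_misalign_le_re_of_eq_cexp {K c₀ : ℝ} {ρ : (Site L' M → ℝ) → ℂ}
    (h : CoerciveWeight K c₀ L' M ρ) {θ : Site L' M → ℝ} {S : ℂ} (hρ : ρ θ = Complex.exp (-S)) :
    c₀ * K * misalign θ ≤ S.re := by
  have h1 := h.coercive θ
  rw [hρ, Complex.norm_exp, Complex.neg_re, Real.exp_le_exp] at h1
  linarith

/-- **Coercivity of the small-field action of a format member**: on a small-field configuration the
total action `S θ = Σ_X A X θ` of the member's OWN representation satisfies `c₀ K · misalign θ ≤ Re S θ`.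
[folklore] -/
theorem StepOneFormat.exists_action_re_ge {K B c₀ cL κ : ℝ} {ρ : (Site L' M → ℝ) → ℂ}
    (h : StepOneFormat K B c₀ cL κ L' M ρ) {θ : Site L' M → ℝ} (hθ : lfSet K θ = ∅) :
    ∃ (A : Finset (Site L' M) → (Site L' M → ℂ) → ℂ), QuasiLocalAction K B κ L' M A ∧
      ρ θ = Complex.exp (-(∑ X : Finset (Site L' M), A X (fun s => (θ s : ℂ)))) ∧
        c₀ * K * misalign θ ≤ (∑ X : Finset (Site L' M), A X (fun s => (θ s : ℂ))).re := by
  obtain ⟨A, hA, hρ⟩ := h.apply_of_lfSet_eq_empty hθ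
  exact ⟨A, hA, hρ, h.1.mul_misalign_le_re_of_eq_cexp hρ⟩

end Literature.Probability.LatticeModels.BalabanStepOne

end
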